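/-
Origin: expansion seat `planner-pub-hodgecm-pv15-g2-0`, handover #10 2026-08-18T07:20:49Z (`HOME/pub-hodgecm-pv15-g2/lean/Pv15g2/KernelCompactUnfold.lean`, md5 001637ed, 83 lines);
landed by the gen-7 packager in gate run 26 as `HodgeCM/Automorphic/KernelCompactUnfold.lean` (import ^import Pv15g2\.→import HodgeCM.Automorphic. ×2).
-/
/-
Origin: HOME/pub-hodgecm-pv15-g2/lean/Pv15g2/KernelCompactUnfold.lean — session planner-pub-hodgecm-pv15-g2-0
(unit pub-hodgecm-pv15-g2, DAG-NODE PROVER #15 gen 2; lineage N23a → N23c input `unfold` [AX12(ii)]).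
Intended final place (packager's call): `HodgeCM/Automorphic/KernelCompactUnfold.lean`.
NEW, ADDITIVE LEAF; imports my queued `Pv15g2.KernelModelUnfold` (↦ `HodgeCM.Automorphic.KernelModelUnfold`, run-25 file
8/8) and `Pv15g2.TorusUnfold` (↦ `HodgeCM.Automorphic.TorusUnfold`, file 9/9).  KIND: KERNEL — nothing cited/posited.
-/
import Summits.HodgeConjecture.HodgeCM.Automorphic.KernelModelUnfold
import Summits.HodgeConjecture.HodgeCM.Automorphic.TorusUnfold

/-!
# `CompactTorusDatum.unfold` [AX12(ii)] for the kernel-model torus carrier and the compact model `[T] = T ⧸ Λ`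

pv06-g3's `CompactTorusDatum ν C D` (queued `HodgeCM/PerL34/AnnihilationModel.lean`, v5) types the Step-2 input of
PerL v5 Prop 3.6 (ll. 423–426) as the field

  `unfold : ∀ x χ, (∀ f, ⟪D.E χ f, toLp x⟫ = 0) → ∀ h : G, periodCLM μK (emb χ) (res (translC h x)) = 0`.

`KernelTorusCarrier.unfold_holds` (file `KernelModelUnfold`) proves it for every period model satisfying the β-period
equation `hP`; `TorusUnfold.betaPeriod_eq_quotientPeriod` proves `hP` for the compact quotient.  This file COMBINES the
two: for the kernel-model torus carrier `Dk` and the compact model `K := T ⧸ Λ`, `μK := map π (ν|𝓕)` (`𝓕` a fundamental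
domain of the lattice `Λ = T(L₀)` in `T = T(𝔸)`, `β` a `Λ`-partition of unity — PerL v5 l. 405), the field `unfold` HOLDS
for ANY `res`, `emb` satisfying the two defining equations `res y (π t) = y (π (jT t)⁻¹)` and
`dualChar (emb χ) (π t) = χᵥ χ t` — `KernelTorusCarrier.unfold_holds_periodCLM`.  No identification is left.
-/

set_option autoImplicit false

noncomputable section

open MeasureTheory Set Filter Function Topology
open scoped InnerProductSpace CompactlySupported ComplexConjugate

attribute [-instance] Quotient.instMeasurableSpace

namespace HodgeCM

open HodgeCM.PerL34 HodgeCM.PerL34.N23a HodgeCM.PerL34.Annihilation HodgeCM.RegularRep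

namespace KernelTorusCarrier

variable {G : Type} [Group G] [TopologicalSpace G] [IsTopologicalGroup G] [T2Space G] [LocallyCompactSpace G]
  [MeasurableSpace G] [BorelSpace G]
variable {Γ : Subgroup G} [DiscreteTopology Γ] [IsClosed (Γ : Set G)] [MeasurableSpace (G ⧸ Γ)] [BorelSpace (G ⧸ Γ)]
  [CompactSpace (G ⧸ Γ)]
variable {μQ : Measure (G ⧸ Γ)} [SMulInvariantMeasure G (G ⧸ Γ) μQ] [IsFiniteMeasure μQ]
variable {XU : Type} [TopologicalSpace XU] [CompactSpace XU]
variable {HG : Type} [NormedAddCommGroup HG] [InnerProductSpace ℂ HG] [CompleteSpace HG]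
variable {SK SigIdxG : Type} [TopologicalSpace SK]
variable {K : KernelCoreCarrier G Γ μQ XU HG SK SigIdxG}
variable {T : Type} [Group T] [TopologicalSpace T] [IsTopologicalGroup T] [T2Space T] [MeasurableSpace T] [BorelSpace T]
variable (Dk : KernelTorusCarrier K T) [IsFiniteMeasureOnCompacts Dk.ν] [Dk.ν.IsMulRightInvariant]
variable {Λ : Subgroup T} [Λ.Normal] [Countable Λ] [MeasurableSpace (T ⧸ Λ)] [BorelSpace (T ⧸ Λ)] [CompactSpace (T ⧸ Λ)]

/-- **`CompactTorusDatum.unfold` [AX12(ii)] PROVED for the kernel-model torus carrier and the compact model `K = T ⧸ Λ`,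
`μK = map π (ν|𝓕)`**: for every `res : C(G ⧸ Γ, ℂ) →L[ℂ] C(T ⧸ Λ, ℂ)` with `res y (π t) = y (π (jT t)⁻¹)` and every
`emb : X → PontryaginDual (T ⧸ Λ)` with `dualChar (emb χ) (π t) = χᵥ χ t`,
`x ⟂ 𝓔_χ` in `L²(μQ)` forces `periodCLM μK (emb χ) (res (translC h x)) = 0` for all `h ∈ G` (PerL v5 ll. 423–426). -/
theorem unfold_holds_periodCLM {μ : Measure G} (hM : IsCocompactHaarModel Γ μQ μ)
    {𝓕 : Set T} (h𝓕 : IsFundamentalDomain Λ.op 𝓕 Dk.ν)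
    (μK : Measure (T ⧸ Λ)) [IsFiniteMeasure μK]
    (hμK : μK = Measure.map (QuotientGroup.mk : T → T ⧸ Λ) (Dk.ν.restrict 𝓕))
    (hβ1 : ∀ t : T, ∑' a : Λ.op, (Dk.β (a • t) : ℂ) = 1)
    (res : C(G ⧸ Γ, ℂ) →L[ℂ] C(T ⧸ Λ, ℂ))
    (hres : ∀ (y : C(G ⧸ Γ, ℂ)) (t : T), res y (QuotientGroup.mk t) = y (QuotientGroup.mk (Dk.jT t)⁻¹))
    (emb : Dk.X → PontryaginDual (T ⧸ Λ))
    (hemb : ∀ (χ : Dk.X) (t : T), dualChar (emb χ) (QuotientGroup.mk t) = Dk.χv χ t) :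
    ∀ (x : C(G ⧸ Γ, ℂ)) (χ : Dk.X),
      (∀ f, ⟪Dk.toRegTorusCarrier.toRepTorusCarrier.E χ f, ContinuousMap.toLp (E := ℂ) 2 μQ ℂ x⟫_ℂ = 0) →
      ∀ h : G, periodCLM μK (emb χ) (res (translC h x)) = 0 := by
  intro x χ hx h
  have main := Dk.unfold_holds hM (fun ξ => (periodCLM μK ξ).comp res) emb (fun χ y => by
    rw [ContinuousLinearMap.comp_apply, periodCLM_apply, hμK]
    exact (TorusUnfold.betaPeriod_eq_quotientPeriod h𝓕 (Dk.β : T → ℝ) Dk.β.continuous Dk.β.hasCompactSupport hβ1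
      (Dk.χv χ : T → ℂ) (fun t : T => (QuotientGroup.mk (Dk.jT t)⁻¹ : G ⧸ Γ)) (y : G ⧸ Γ → ℂ) (res y) (hres y)
      (ContinuousMap.mk (fun k => dualChar (emb χ) k) (continuous_dualChar (emb χ))) (hemb χ)).symm) x χ hx h
  simpa only [ContinuousLinearMap.comp_apply] using main

end KernelTorusCarrier

end HodgeCM

end
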